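import Summits.ABC.ABC.Theses.IsogenyGlueCongruence
import Literature.NumberTheory.EllipticCurves.PastenSpectralDegreeIsogenyBoundProofs
import Literature.NumberTheory.EllipticCurves.CuspFormLFunctionLevelConductorProofs
import Literature.NumberTheory.EllipticCurves.RootNumberAtkinLehnerSemistableProofs
import Literature.NumberTheory.EllipticCurves.BSDRootNumberLocalTablesProofs
import Literature.NumberTheory.DiophantineGeometry.PastenValuationProductsProofs
import Literature.NumberTheory.Automorphic.BrandtXi

set_option linter.dupNamespace false

/-!
# Crux `SharpDegreeOfPolyDegree` (stmt-ABC-10895), line `Sketch`: the optimal comparison (OC)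

`R := SharpDegreeOfPolyDegree = (Poly → X)`.  This support file (lands `--supports stmt-ABC-10895`)
proves the registered stub `stub_optimalComparison` of the line's skeleton
(`Cruxes/SharpDegreeOfPolyDegree/Lines/Sketch.lean`), verbatim: granted Pasten's `163`-fact
`PastenShimura2024_minimalDegree_le_163_mul` (a hypothesis here, not discharged), a datum `D` of
minimal degree among the data of a semistable, globally minimal elliptic `W/ℚ` at level `N = N_W`
satisfies `deg D ≤ 163 · deg D₀` for an optimal datum `D₀` — of minimal degree among ALL data, of
all curves, with the same newform — of a curve `W₀/ℚ` which is semistable, has conductor `N_W` and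
the same `a`-sequence as `W`.

Ingredients (all tree theorems): the optimal datum is `ModularParametrizationData.exists_optimalDatum'`
(`c₀ Λ_f = Λ_{E₀}`), of minimal degree in the class by `isogenyMap_ker_eq_bot_iff` and
`modularDegree_le_of_isogenyMap_ker_eq_bot`; `aₙ(W₀) = aₙ(f) = aₙ(W)` since `D₀.f = D.f`
(`IsNewformOf`); the conductor of `W₀` is squarefree — a prime `p` with `p² ∣ N_{W₀}` is additive for
`W₀` (`natGenerator_sq_dvd_conductorNorm_iff`), so `a_p(W₀) = 0`
(`LFunction_apply_primesEquiv_of_hasAdditiveReductionAt`), while `p ∣ N_{W₀}` gives `p ∣ N_W`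
(`IsNewformOf.dvd_level_iff_dvd_conductorNorm`) and `a_p(W) = ±1`
(`LFunction_apply_ne_zero_of_dvd_of_squarefree`) — hence equal to the level `N_W`
(`IsNewformOf.level_eq_conductorNorm_of_squarefree`, the semistable case of Carayol's theorem) and
`W₀` is semistable (`isSemistable_iff_squarefree_conductorNorm`).

Theorems only (no definition, no named fact); the `163`-fact is a hypothesis, `R` itself is not
touched here.
-/

noncomputable section

namespace Summit.ABC.ABC.Theorems.SharpDegreeOfPolyDegree

open Literature.NumberTheory.EllipticCurves Literature.NumberTheory.EllipticCurves.ModularForms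
open Literature.NumberTheory.DiophantineGeometry Literature.NumberTheory.Automorphic
open WeierstrassCurve

/-! ## Curves with a common newform -/

/-- Two elliptic curves over `ℚ` carrying parametrisation data with the same newform have the same
`a`-sequence: `aₙ(W₀) = aₙ(f) = aₙ(W)` (`IsNewformOf`, `WeierstrassCurve.LFunction` is `ℤ`-valued).
[folklore] -/
theorem lFunction_eq_of_f_eq {N : ℕ} [NeZero N] {W₀ W : WeierstrassCurve ℚ}
    (D₀ : ModularParametrizationData W₀ N) (D : ModularParametrizationData W N) (hf : D₀.f = D.f)
    (n : ℕ) : W₀.LFunction n = W.LFunction n := by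
  have h₀ := D₀.isNewformOf.2 n
  have h := D.isNewformOf.2 n
  rw [hf] at h₀
  rw [h₀] at h
  exact_mod_cast h

/-- **The conductor of a curve sharing its newform with a semistable curve is squarefree.** If
`W/ℚ` has squarefree conductor and `W₀/ℚ` carries a datum at some level with the same newform as a
datum of `W`, then `N_{W₀}` is squarefree: were `p² ∣ N_{W₀}`, the place over `p` would be additive
for `W₀` (`natGenerator_sq_dvd_conductorNorm_iff`, Silverman ATAEC IV.10.2(c)), forcing
`a_p(W₀) = 0` (`LFunction_apply_primesEquiv_of_hasAdditiveReductionAt`); but `p ∣ N_{W₀}` gives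
`p ∣ N` (level) and `p ∣ N_W` (`IsNewformOf.dvd_level_iff_dvd_conductorNorm`, twice), where
`a_p(W) = ±1 ≠ 0` (`LFunction_apply_ne_zero_of_dvd_of_squarefree`), and `a_p(W₀) = a_p(W)`.
[folklore] -/
theorem squarefree_conductorNorm_of_f_eq {N : ℕ} [NeZero N] {W₀ W : WeierstrassCurve ℚ}
    [W₀.IsElliptic] [W.IsElliptic] (D₀ : ModularParametrizationData W₀ N)
    (D : ModularParametrizationData W N) (hf : D₀.f = D.f)
    (hsq : Squarefree (W.conductorNorm ℤ)) : Squarefree (W₀.conductorNorm ℤ) := by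
  rw [Nat.squarefree_iff_prime_squarefree]
  intro p hp hp2
  -- `p ∣ N_{W₀}`, hence `p ∣ N` and `p ∣ N_W`
  have hpW₀ : p ∣ W₀.conductorNorm ℤ := dvd_trans (dvd_mul_right p p) hp2
  have hpN : p ∣ N := (D₀.isNewformOf.dvd_level_iff_dvd_conductorNorm hp).mpr hpW₀
  have hpW : p ∣ W.conductorNorm ℤ := (D.isNewformOf.dvd_level_iff_dvd_conductorNorm hp).mp hpN
  -- `a_p(W) ≠ 0`
  have hne : W.LFunction p ≠ 0 := W.LFunction_apply_ne_zero_of_dvd_of_squarefree hsq ⟨p, hp⟩ hpW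
  -- the place of `ℤ` over `p` is additive for `W₀`, so `a_p(W₀) = 0`
  set v : IsDedekindDomain.HeightOneSpectrum ℤ :=
    (Rat.HeightOneSpectrum.primesEquiv (R := ℤ)).symm ⟨p, hp⟩ with hv
  have hgen : Rat.HeightOneSpectrum.natGenerator v = p :=
    congrArg (fun q : Nat.Primes ↦ (q : ℕ))
      ((Rat.HeightOneSpectrum.primesEquiv (R := ℤ)).apply_symm_apply ⟨p, hp⟩)
  have hadd : W₀.HasAdditiveReductionAt v := by
    rw [← natGenerator_sq_dvd_conductorNorm_iff v W₀, hgen, sq]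
    exact hp2
  have hadd' : W₀.HasAdditiveReductionAt
      ((Rat.HeightOneSpectrum.primesEquiv (R := NumberField.RingOfIntegers ℚ)).symm ⟨p, hp⟩) :=
    (W₀.hasAdditiveReductionAt_int_iff_ringOfIntegers ⟨p, hp⟩).mp hadd
  have h0 := W₀.LFunction_apply_primesEquiv_of_hasAdditiveReductionAt hadd'
  rw [Equiv.apply_symm_apply] at h0
  -- `a_p(W₀) = a_p(W)`
  have heq : W₀.LFunction p = W.LFunction p := lFunction_eq_of_f_eq D₀ D hf p
  exact hne (heq ▸ h0)

/-! ## The stub -/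

/-- **(OC) The optimal comparison from Pasten's `163`-fact** — the registered stub
`stub_optimalComparison` of the line's skeleton (`Cruxes/SharpDegreeOfPolyDegree/Lines/Sketch.lean`),
verbatim.  Granted `PastenShimura2024_minimalDegree_le_163_mul` (Pasten 2024, §3 p. 13: Mazur–Kenku),
a datum `D` of minimal degree among the data of a semistable `W/ℚ` in global minimal form, at level
`N_W`, has `deg D ≤ 163 · deg D₀` for an optimal datum `D₀` (`exists_optimalDatum'`; minimal among
all data with the same newform, `modularDegree_le_of_isogenyMap_ker_eq_bot`) of a curve `W₀` with
the same `a`-sequence (`lFunction_eq_of_f_eq`), squarefree conductor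
(`squarefree_conductorNorm_of_f_eq`) equal to the level `N_W`
(`IsNewformOf.level_eq_conductorNorm_of_squarefree`), hence semistable
(`isSemistable_iff_squarefree_conductorNorm`). [cite: PastenShimura2024, §3 p. 13] -/
theorem stub_optimalComparison :
    PastenShimura2024_minimalDegree_le_163_mul →
    ∀ (W : WeierstrassCurve ℚ) [W.IsElliptic] [W.IsGloballyMinimal] [NeZero (W.conductorNorm ℤ)],
      W.IsSemistable ℤ → ∀ D : ModularParametrizationData W (W.conductorNorm ℤ),
        (∀ D' : ModularParametrizationData W (W.conductorNorm ℤ),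
            D.modularDegree ≤ D'.modularDegree) →
          ∃ (W₀ : WeierstrassCurve ℚ) (_ : W₀.IsElliptic)
            (D₀ : ModularParametrizationData W₀ (W.conductorNorm ℤ)),
            W₀.IsSemistable ℤ ∧ W₀.conductorNorm ℤ = W.conductorNorm ℤ ∧
              (∀ n : ℕ, W₀.LFunction n = W.LFunction n) ∧
              (∀ (W' : WeierstrassCurve ℚ) [W'.IsElliptic]
                  (D' : ModularParametrizationData W' (W.conductorNorm ℤ)),
                  D'.f = D₀.f → D₀.modularDegree ≤ D'.modularDegree) ∧
              D.modularDegree ≤ 163 * D₀.modularDegree := by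
  intro h163 W _ _ _ hss D hmin
  -- an optimal datum `D₀` with newform `D.f`, of minimal degree in the class
  obtain ⟨W₀, hW₀, D₀, hf₀, h₀⟩ := D.exists_optimalDatum'
  haveI := hW₀
  have hker₀ : D₀.isogenyMap.ker = ⊥ := D₀.isogenyMap_ker_eq_bot_iff.mpr h₀
  have hmin₀ : ∀ (W' : WeierstrassCurve ℚ) [W'.IsElliptic]
      (D' : ModularParametrizationData W' (W.conductorNorm ℤ)), D'.f = D₀.f →
        D₀.modularDegree ≤ D'.modularDegree := fun W' _ D' hD' ↦
    D₀.modularDegree_le_of_isogenyMap_ker_eq_bot hker₀ D' hD'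
  -- squarefree conductors: `N_W` (semistable) and `N_{W₀}` (same newform)
  have hsq : Squarefree (W.conductorNorm ℤ) := (W.isSemistable_iff_squarefree_conductorNorm).mp hss
  have hsq₀ : Squarefree (W₀.conductorNorm ℤ) := squarefree_conductorNorm_of_f_eq D₀ D hf₀ hsq
  -- level `=` conductor for `W₀` (Carayol, semistable case)
  have hN₀ : W.conductorNorm ℤ = W₀.conductorNorm ℤ :=
    D₀.isNewformOf.level_eq_conductorNorm_of_squarefree hsq₀
  refine ⟨W₀, hW₀, D₀, (W₀.isSemistable_iff_squarefree_conductorNorm).mpr hsq₀, hN₀.symm,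
    lFunction_eq_of_f_eq D₀ D hf₀, hmin₀, ?_⟩
  -- the fact: `deg D ≤ 163 · deg D₀`
  exact h163 (W.conductorNorm ℤ) W₀ W D₀ D hf₀.symm hmin₀ hmin

end Summit.ABC.ABC.Theorems.SharpDegreeOfPolyDegree

end
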